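import Summits.QuantumFields.BalabanUV.Beta.D1BFx.StencilDictionaryTorus
import Summits.QuantumFields.BalabanUV.Beta.D1BFx.StencilKernels
import Summits.QuantumFields.BalabanUV.Beta.D1BFx.FibredPeriodisation

/-!
# `BalabanUV.Beta.D1BFx.StencilDictionaryEntries` — road «BF-x» for binder row D1, slot (K), X₁ brick Q2 «LOCAL STENCIL DICTIONARY an5 ↔ an2», FILE 4 (the ENTRY form):
# on the fine CUBIC torus `Tor (fine n (cubic d p)) = Beta.Site d (n·p)` an5's `Lap`, `QvAdj·QvOp`, `GradOp`, `GradOpᴴ` ARE an4-PERIODISATIONS (`periodise₂`, Q1's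
# `periodiseF`) of the `ℤ^d` kernels `lapKer ⊗ δ`, `qqKer n ⊗ δ`, `dzKer`, `codiffKer` of FILE 3 — every torus point, every side `p ≥ 1`

WHY (`HOME/b2b-balaban-beta-d1-p2/X1-SPEC.md` v1 §1 brick Q2 as literally specified: «entrywise … = n²·periodise₂-fib of the ℤ^d kernels»; owner request journal l.19726 «state the
an5-side entries through `siteOf` ∕ a `Tor ≃ Site` identification so Q3c ∕ Q4 compose»).  Brick Q4 (Tannery assembly) reads an5's per-volume identity `DeltaA_t · calG_t = 1`
as `Σ_z DeltaA_t(x̄, z)·g(z)` and wants `DeltaA_t` as `n²·periodiseF (Δ^∞)`; bricks Q3b ∕ Q3c supply the gauge sandwich in that currency on `Beta.Site 4 s`.  THIS FILE supplies the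
two LOCAL terms and the two LETTERS in exactly that currency, by composing FILE 2 (operator on the lift), FILE 3 (kernel + comb lemma) and Q1's `periodiseF` (p232434) BY NAME:
a matrix entry is the operator applied to a torus Kronecker delta (`apply_eq_mulVec_single`), the lift of a torus Kronecker delta is the comb `𝟙[w̄ = z̄]` (`liftT1_single` ∕
`liftT0_single`), the stencil of the comb is the kernel row summed over the coset = `periodise₂` (FILE 3's `tsum_mul_comb_eq_periodise₂`).  No «torus wider than the stencil»
hypothesis: `periodise₂` sums EVERY image, so the identities hold for all `p ≥ 1` (multiple images simply add up on small tori).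

WHAT THIS FILE PROVES (all [folklore]; two [our object] fibre-diagonal kernel definitions `lapF`, `qqF n` on `(ℤ^d × Fin d)²` asserting nothing; any dimension `d`):
* §1 `tor_fine_cubic : Tor (fine n (cubic d p)) = Site d (n * p)` and `castT_fine_cubic : castT (fine n (cubic d p)) x = siteOf d (n * p) x` — both `rfl`.
* §2 `apply_eq_mulVec_single` (`T i j = (T *ᵥ Pi.single j 1) i`), `liftT1_single` ∕ `liftT0_single` (lift of a torus Kronecker delta = the real comb cast to `ℂ`), cast lemmas
  `codiff₁_dz_ofReal`, `dz_ofReal`, `codiff₁_ofReal`, `sum_range_contourSum_ofReal`.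
* §3 ENTRIES at reduced points `castT … x`, `castT … z` (`x z : ℤ^d`): **`Lap_entry`** `Lap n (cubic d p) (x̄,κ) (z̄,l) = ↑(n² · 𝟙[κ=l] · periodise₂ (n·p) lapKer x̄ z̄)`,
  `sum_range_contourSum_liftT1_single`, **`QvAdj_QvOp_entry`** `= ↑(n^d·(n^{−(d+1)})² · 𝟙[κ=l] · periodise₂ (n·p) (qqKer n κ) x̄ z̄)`, **`GradOp_entry`** `= ↑(n · periodise₂ (n·p) (dzKer ν) x̄ z̄)`,
  **`GradOp_conjTranspose_entry`** `= ↑(n · periodise₂ (n·p) (codiffKer l) x̄ z̄)`.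
* §4 the SAME FOUR ENTRIES indexed by arbitrary an4 torus points `xb zb : Site d (n·p)` (`…_site`; via `windowMap` ∕ `siteOf_windowMap`).
* §5 Q1's vocabulary: `Kfib_lapF`, `Kfib_qqF`, `Lap_eq_periodiseF` ∕ `QvAdj_QvOp_eq_periodiseF` (reduced points) and the MATRIX FORMS on `Site d (n·p) × Fin d`
  **`Lap_eq_periodiseF_site : Lap n (cubic d p) i j = ↑(n² · periodiseF (n·p) lapF i j)`**, **`QvAdj_QvOp_eq_periodiseF_site : (QvAdj·QvOp) i j = ↑(n^d·(n^{−(d+1)})² · periodiseF (n·p) (qqF n) i j)`**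
  for ALL `i j`.

HONEST FRAMING (cell contract, verbatim): «discharging `BetaPertH` makes Bałaban's UV stability UNCONDITIONAL — a real constructive-QFT result; it is NOT the continuum
limit and NOT the Clay problem.»  HONEST DEPENDENCY (verbatim): «continuum YM on T⁴ ⇐ BetaPertH ∧ nine spine estimates (0/9 proved); BetaPertH ⇐ (D1) ∧ (D4) ∧ CAP+tail;
G-an2-4 gates asym, D1 and NE2/3/4.»  [folklore] carrier bookkeeping between two typists' tori and `ℤ^d` for the cell's OWN typed objects; no `Prop` is minted, nothing is cited,
no wall binder is instantiated; the gauge sandwich `GradOp·PcT·GradOpᴴ` is NOT touched (Q3b ∕ Q3c), (X₁a) is NOT touched (Q4 assembles); 0 sorry.  NOT summit progress, NOT D1,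
NOT BetaPertH.
ABSOLUTE RULE (cell, verbatim): «No internally-minted statement may enter as a cited fact. Every hypothesis is either kernel-proved in this package or a verbatim quotation
of a PUBLISHED theorem with page reference. The manuscript(s) under audit are NOT citable for their own disputed steps — they are the thing under adjudication;
programme-internal (2001/route/tribunal) claims are never citable.»
Provenance: G-an2-4 swarm leaf seat `b2b-balaban-gan24-formalise-leaf-06` gen 28 (prover-b2b-balaban-gan24-formalise-leaf-06-g28-0; cross-lane idle-seat duty G-an2-4 → D1,
road «BF-x», CLAIM «X1-Q2» journal l.19491; FILE 1 `HodgeIdentityForms` p232119, FILE 2 `StencilDictionaryTorus` p232616, FILE 3 `StencilKernels` p232976; Q1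
`FibredPeriodisation` p232434 by `b2b-balaban-beta-d1-formalise-leaf-03`), 2026-08-20.
-/

namespace Summit.QuantumFields.BalabanUV.Beta.D1BFx.StencilDictionaryEntries

open Literature.MathematicalPhysics.QuantumFieldTheory.Balaban1983to89
open Literature.MathematicalPhysics.QuantumFieldTheory.Balaban1983to89.Beta
open B5Prop11Plancherel (Tor fine)
open B5Prop11Lower (Lap)
open B5Action121 (GradOp)
open B5Block118 (QvOp)
open B5DeltaA169 (QvAdj)
open FreeLegDictionary (cubic)
open VectorTails (castT)
open AffineAveraging (Form0 Form1 unitVec dz codiff₁ contourSum)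
open AffineReproduction (contourSumAdj)
open AveragingContours (blk)
open B6QGQLower276 (lapKer)
open StencilDictionaryTorus (liftT0 liftT1 liftT0_apply liftT1_apply Lap_mulVec_castT QvAdj_QvOp_mulVec_castT GradOp_mulVec_castT
  GradOp_conjTranspose_mulVec_castT)
open StencilKernels (dzKer codiffKer qqKer codiff₁_dz_eq_tsum_lapKer dz_eq_tsum_dzKer codiff₁_eq_sum_tsum_codiffKer
  contourSumAdj_contourSum_eq_sum contourSumAdj_contourSum_eq_tsum tsum_mul_comb_eq_periodise₂ isPeriodic₂_lapKer summable_lapKer_row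
  isPeriodic₂_dzKer summable_dzKer_row isPeriodic₂_codiffKer summable_codiffKer_row isPeriodic₂_qqKer summable_qqKer_row)
open FibredPeriodisation (FKer Kfib periodiseF periodiseF_apply periodise₂_zero)
open scoped Matrix ComplexConjugate

noncomputable section

variable {d : ℕ} (n p : ℕ) [NeZero n] [NeZero p]

/-! ## §1 The carrier: an5's fine cubic torus IS an4's `Beta.Site d (n·p)`, and `castT` IS `siteOf` -/

omit [NeZero n] [NeZero p] in
/-- [folklore] **CARRIER IDENTIFICATION** (definitional): an5's fine torus over the cubic coarse torus of side `p`, `Tor (fine n (cubic d p)) = Π_μ ℤ∕(n·p)`, IS an4's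
cubic torus `Beta.Site d (n * p) = (Fin d → ℤ∕(n·p))`. -/
theorem tor_fine_cubic : Tor (fine n (cubic d p)) = Site d (n * p) := rfl

omit [NeZero n] [NeZero p] in
/-- [folklore] … and an5's reduction `castT` IS an4's `siteOf` (definitional). -/
theorem castT_fine_cubic (x : Fin d → ℤ) : castT (fine n (cubic d p)) x = siteOf d (n * p) x := rfl

/-! ## §2 Tools: a matrix entry is the action on a Kronecker delta; the lift of a torus Kronecker delta is the comb; real casts -/

/-- [folklore] A matrix entry is the matrix applied to a Kronecker delta: `T i j = (T *ᵥ δ_j) i`. -/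
theorem apply_eq_mulVec_single {I J : Type*} [Fintype J] [DecidableEq J] (T : Matrix I J ℂ) (i : I) (j : J) :
    T i j = (T *ᵥ Pi.single j 1) i := by
  simp only [Matrix.mulVec, dotProduct, Pi.single_apply, mul_ite, mul_one, mul_zero, Finset.sum_ite_eq',
    Finset.mem_univ, if_true]

omit [NeZero n] [NeZero p] in
/-- [folklore] **THE LIFT OF A TORUS KRONECKER 1-FORM IS THE COMB**: `(δ_{(z̄,l)})♯ κ w = 𝟙[κ = l ∧ w̄ = z̄]` (real comb cast to `ℂ`). -/
theorem liftT1_single (z : Fin d → ℤ) (l : Fin d) :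
    liftT1 (fine n (cubic d p)) (Pi.single (siteOf d (n * p) z, l) (1 : ℂ))
      = fun κ w => (((if κ = l ∧ siteOf d (n * p) w = siteOf d (n * p) z then (1 : ℝ) else 0) : ℝ) : ℂ) := by
  funext κ w
  simp only [liftT1_apply, castT_fine_cubic, Pi.single_apply, Prod.mk.injEq]
  by_cases hκ : κ = l <;> by_cases hw : siteOf d (n * p) w = siteOf d (n * p) z <;> simp [hκ, hw]

omit [NeZero n] [NeZero p] in
/-- [folklore] The lift of a torus Kronecker 0-form is the comb: `(δ_{z̄})♯ w = 𝟙[w̄ = z̄]`. -/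
theorem liftT0_single (z : Fin d → ℤ) :
    liftT0 (fine n (cubic d p)) (Pi.single (siteOf d (n * p) z) (1 : ℂ))
      = fun w => (((if siteOf d (n * p) w = siteOf d (n * p) z then (1 : ℝ) else 0) : ℝ) : ℂ) := by
  funext w
  simp only [liftT0_apply, castT_fine_cubic, Pi.single_apply]
  by_cases hw : siteOf d (n * p) w = siteOf d (n * p) z <;> simp [hw]

/-- [folklore] `codiff₁ ∘ dz` commutes with the real-to-complex cast. -/
theorem codiff₁_dz_ofReal (f : Form0 d ℝ) (x : Fin d → ℤ) :
    codiff₁ (dz fun w => ((f w : ℝ) : ℂ)) x = ((codiff₁ (dz f) x : ℝ) : ℂ) := by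
  simp only [codiff₁, dz]
  push_cast
  rfl

/-- [folklore] `dz` commutes with the real-to-complex cast. -/
theorem dz_ofReal (f : Form0 d ℝ) (ν : Fin d) (x : Fin d → ℤ) :
    dz (fun w => ((f w : ℝ) : ℂ)) ν x = ((dz f ν x : ℝ) : ℂ) := by
  simp only [dz]
  push_cast
  rfl

/-- [folklore] `codiff₁` commutes with the real-to-complex cast. -/
theorem codiff₁_ofReal (G : Form1 d ℝ) (x : Fin d → ℤ) :
    codiff₁ (fun κ w => ((G κ w : ℝ) : ℂ)) x = ((codiff₁ G x : ℝ) : ℂ) := by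
  simp only [codiff₁]
  push_cast
  rfl

omit [NeZero n] in
/-- [folklore] The floor-form `𝒬ᵀ𝒬` sum commutes with the real-to-complex cast. -/
theorem sum_range_contourSum_ofReal (G : Form1 d ℝ) (κ : Fin d) (x : Fin d → ℤ) :
    ∑ s ∈ Finset.range n, contourSum n (fun κ w => ((G κ w : ℝ) : ℂ)) κ (blk n (x - (s : ℤ) • unitVec κ))
      = ((∑ s ∈ Finset.range n, contourSum n G κ (blk n (x - (s : ℤ) • unitVec κ)) : ℝ) : ℂ) := by
  simp only [contourSum]
  push_cast
  rfl

/-! ## §3 THE ENTRIES: an5's local torus operators ARE an4-periodisations of the `ℤ^d` kernels — every torus point, every `p ≥ 1` -/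

/-- [folklore] **`Lap` ENTRY**: `Lap n (cubic d p) (x̄, κ) (z̄, l) = n² · 𝟙[κ = l] · periodise₂ (n·p) lapKer x̄ z̄` — an5's vector Laplacian on the fine cubic torus IS
`n²` times the periodisation of pv23's positive Laplacian kernel, DIAGONAL in the component index (FILE 1's Hodge identity in entry form), for EVERY torus side
(`periodise₂` sums all images, no «torus wider than the stencil» hypothesis). -/
theorem Lap_entry (x z : Fin d → ℤ) (κ l : Fin d) :
    Lap n (cubic d p) (castT (fine n (cubic d p)) x, κ) (castT (fine n (cubic d p)) z, l)
      = (((n : ℝ) ^ 2 * (if κ = l then periodise₂ (n * p) (lapKer (d := d)) (siteOf d (n * p) x) (siteOf d (n * p) z) else 0)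
          : ℝ) : ℂ) := by
  rw [apply_eq_mulVec_single (Lap n (cubic d p)), Lap_mulVec_castT, castT_fine_cubic, liftT1_single]
  by_cases hκ : κ = l
  · subst hκ
    simp only [true_and, if_true]
    rw [codiff₁_dz_ofReal, codiff₁_dz_eq_tsum_lapKer,
      tsum_mul_comb_eq_periodise₂ (isPeriodic₂_lapKer (n * p)) summable_lapKer_row]
    push_cast
    ring
  · simp only [hκ, false_and, if_false, mul_zero, Complex.ofReal_zero]
    simp [codiff₁, dz]

/-- [folklore] The floor-form `𝒬ᵀ𝒬` sum of the lifted torus Kronecker 1-form IS the periodised `qqKer` entry (diagonal in the component). -/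
theorem sum_range_contourSum_liftT1_single (x z : Fin d → ℤ) (κ l : Fin d) :
    ∑ s ∈ Finset.range n, contourSum n (liftT1 (fine n (cubic d p)) (Pi.single (siteOf d (n * p) z, l) (1 : ℂ))) κ
        (blk n (x - (s : ℤ) • unitVec κ))
      = if κ = l then ((periodise₂ (n * p) (qqKer n κ) (siteOf d (n * p) x) (siteOf d (n * p) z) : ℝ) : ℂ) else 0 := by
  have hn : 1 ≤ n := NeZero.one_le
  by_cases hκ : κ = l
  · subst hκ
    rw [if_pos rfl]
    have hreal : ∑ s ∈ Finset.range n, contourSum n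
        (fun (_ : Fin d) (w : Fin d → ℤ) => if siteOf d (n * p) w = siteOf d (n * p) z then (1 : ℝ) else 0) κ
        (blk n (x - (s : ℤ) • unitVec κ)) = periodise₂ (n * p) (qqKer n κ) (siteOf d (n * p) x) (siteOf d (n * p) z) := by
      rw [← contourSumAdj_contourSum_eq_sum, contourSumAdj_contourSum_eq_tsum]
      exact tsum_mul_comb_eq_periodise₂ ((isPeriodic₂_qqKer n hn κ).of_dvd (dvd_mul_right n p)) (summable_qqKer_row n κ) x z
    rw [StencilKernels.sum_range_contourSum_blk] at hreal ⊢
    simp only [liftT1_single, true_and]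
    exact_mod_cast hreal
  · rw [if_neg hκ, StencilKernels.sum_range_contourSum_blk]
    simp [hκ]

/-- [folklore] **`Q*Q` ENTRY**: `(QvAdj · QvOp) (x̄, κ) (z̄, l) = n^d · n^{−2(d+1)} · 𝟙[κ = l] · periodise₂ (n·p) (qqKer n κ) x̄ z̄` — an5's averaging term on the fine
cubic torus IS `n^{−(d+2)}` times the periodisation of the block-averaging kernel of `contourSumAdj n ∘ contourSum n`, diagonal in the component, every `p ≥ 1`. -/
theorem QvAdj_QvOp_entry (x z : Fin d → ℤ) (κ l : Fin d) :
    (QvAdj n (cubic d p) * QvOp n (cubic d p)) (castT (fine n (cubic d p)) x, κ) (castT (fine n (cubic d p)) z, l)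
      = (((n : ℝ) ^ d * (1 / (n : ℝ) ^ (d + 1)) ^ 2 *
          (if κ = l then periodise₂ (n * p) (qqKer n κ) (siteOf d (n * p) x) (siteOf d (n * p) z) else 0) : ℝ) : ℂ) := by
  rw [apply_eq_mulVec_single (QvAdj n (cubic d p) * QvOp n (cubic d p)), QvAdj_QvOp_mulVec_castT, castT_fine_cubic,
    sum_range_contourSum_liftT1_single]
  by_cases hκ : κ = l
  · rw [if_pos hκ, if_pos hκ]
    push_cast
    ring
  · rw [if_neg hκ, if_neg hκ]
    push_cast
    ring

/-- [folklore] **`GradOp` ENTRY** (letter of the gauge sandwich, brick Q3c): `GradOp (fine n (cubic d p)) n (x̄, ν) z̄ = n · periodise₂ (n·p) (dzKer ν) x̄ z̄`. -/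
theorem GradOp_entry (x z : Fin d → ℤ) (ν : Fin d) :
    GradOp (fine n (cubic d p)) (n : ℂ) (castT (fine n (cubic d p)) x, ν) (castT (fine n (cubic d p)) z)
      = (((n : ℝ) * periodise₂ (n * p) (dzKer ν) (siteOf d (n * p) x) (siteOf d (n * p) z) : ℝ) : ℂ) := by
  rw [apply_eq_mulVec_single (GradOp (fine n (cubic d p)) (n : ℂ)), GradOp_mulVec_castT, castT_fine_cubic, liftT0_single,
    dz_ofReal, dz_eq_tsum_dzKer,
    tsum_mul_comb_eq_periodise₂ (isPeriodic₂_dzKer ν (n * p)) (summable_dzKer_row ν)]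
  push_cast
  ring

/-- [folklore] **`GradOpᴴ` ENTRY** (the divergence letter of the gauge sandwich): `(GradOp (fine n (cubic d p)) n)ᴴ x̄ (z̄, l) = n · periodise₂ (n·p) (codiffKer l) x̄ z̄`. -/
theorem GradOp_conjTranspose_entry (x z : Fin d → ℤ) (l : Fin d) :
    (GradOp (fine n (cubic d p)) (n : ℂ))ᴴ (castT (fine n (cubic d p)) x) (castT (fine n (cubic d p)) z, l)
      = (((n : ℝ) * periodise₂ (n * p) (codiffKer l) (siteOf d (n * p) x) (siteOf d (n * p) z) : ℝ) : ℂ) := by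
  rw [apply_eq_mulVec_single ((GradOp (fine n (cubic d p)) (n : ℂ))ᴴ), GradOp_conjTranspose_mulVec_castT, castT_fine_cubic,
    liftT1_single, Complex.conj_natCast]
  rw [show (fun (κ : Fin d) (w : Fin d → ℤ) => (((if κ = l ∧ siteOf d (n * p) w = siteOf d (n * p) z then (1 : ℝ) else 0) : ℝ) : ℂ))
      = fun κ w => (((fun (κ : Fin d) (w : Fin d → ℤ) => if κ = l ∧ siteOf d (n * p) w = siteOf d (n * p) z then (1 : ℝ) else 0) κ w
          : ℝ) : ℂ) from rfl,
    codiff₁_ofReal, codiff₁_eq_sum_tsum_codiffKer, Finset.sum_eq_single l]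
  · simp only [true_and]
    rw [tsum_mul_comb_eq_periodise₂ (isPeriodic₂_codiffKer l (n * p)) (summable_codiffKer_row l)]
    push_cast
    ring
  · intro κ _ hκ
    simp only [hκ, false_and, if_false, mul_zero, tsum_zero]
  · intro h; exact absurd (Finset.mem_univ l) h


/-! ## §4 The same entries INDEXED BY an4's torus points `Site d (n·p)` (the carrier of Q1 ∕ Q3b ∕ Q4; `Tor (fine n (cubic d p))` and `Site d (n·p)` are the
same type definitionally, §1) -/

/-- [folklore] **`Lap` ENTRY on `Site d (n·p)`**: `Lap n (cubic d p) (x̄, κ) (z̄, l) = n² · 𝟙[κ = l] · periodise₂ (n·p) lapKer x̄ z̄` for ALL torus points. -/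
theorem Lap_entry_site (xb zb : Site d (n * p)) (κ l : Fin d) :
    Lap n (cubic d p) (xb, κ) (zb, l)
      = (((n : ℝ) ^ 2 * (if κ = l then periodise₂ (n * p) (lapKer (d := d)) xb zb else 0) : ℝ) : ℂ) := by
  have h := Lap_entry n p (windowMap d (n * p) xb) (windowMap d (n * p) zb) κ l
  simp only [castT_fine_cubic, siteOf_windowMap] at h
  exact h

/-- [folklore] **`Q*Q` ENTRY on `Site d (n·p)`** for ALL torus points. -/
theorem QvAdj_QvOp_entry_site (xb zb : Site d (n * p)) (κ l : Fin d) :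
    (QvAdj n (cubic d p) * QvOp n (cubic d p)) (xb, κ) (zb, l)
      = (((n : ℝ) ^ d * (1 / (n : ℝ) ^ (d + 1)) ^ 2 *
          (if κ = l then periodise₂ (n * p) (qqKer n κ) xb zb else 0) : ℝ) : ℂ) := by
  have h := QvAdj_QvOp_entry n p (windowMap d (n * p) xb) (windowMap d (n * p) zb) κ l
  simp only [castT_fine_cubic, siteOf_windowMap] at h
  exact h

/-- [folklore] **`GradOp` ENTRY on `Site d (n·p)`** for ALL torus points. -/
theorem GradOp_entry_site (xb zb : Site d (n * p)) (ν : Fin d) :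
    GradOp (fine n (cubic d p)) (n : ℂ) (xb, ν) zb = (((n : ℝ) * periodise₂ (n * p) (dzKer ν) xb zb : ℝ) : ℂ) := by
  have h := GradOp_entry n p (windowMap d (n * p) xb) (windowMap d (n * p) zb) ν
  simp only [castT_fine_cubic, siteOf_windowMap] at h
  exact h

/-- [folklore] **`GradOpᴴ` ENTRY on `Site d (n·p)`** for ALL torus points. -/
theorem GradOp_conjTranspose_entry_site (xb zb : Site d (n * p)) (l : Fin d) :
    (GradOp (fine n (cubic d p)) (n : ℂ))ᴴ xb (zb, l) = (((n : ℝ) * periodise₂ (n * p) (codiffKer l) xb zb : ℝ) : ℂ) := by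
  have h := GradOp_conjTranspose_entry n p (windowMap d (n * p) xb) (windowMap d (n * p) zb) l
  simp only [castT_fine_cubic, siteOf_windowMap] at h
  exact h

/-! ## §5 The same in Q1's fibred vocabulary (`FibredPeriodisation.periodiseF`, p232434) -/

/-- [our object] The fibre-diagonal Laplacian kernel on 1-forms: `lapF ((x,κ)) ((w,l)) = 𝟙[κ = l]·lapKer x w`. -/
def lapF : FKer d (Fin d) (Fin d) := fun i j => if i.2 = j.2 then lapKer i.1 j.1 else 0

/-- [our object] The fibre-diagonal block-averaging kernel on 1-forms: `qqF n ((x,κ)) ((w,l)) = 𝟙[κ = l]·qqKer n κ x w`. -/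
def qqF (n : ℕ) : FKer d (Fin d) (Fin d) := fun i j => if i.2 = j.2 then qqKer n i.2 i.1 j.1 else 0

omit [NeZero n] in
/-- [folklore] Fibres of `lapF`: `lapKer` on the diagonal, `0` off it. -/
theorem Kfib_lapF (κ l : Fin d) : Kfib (lapF (d := d)) κ l = if κ = l then lapKer else fun _ _ => 0 := by
  funext x w
  by_cases h : κ = l <;> simp [Kfib, lapF, h]

omit [NeZero n] in
/-- [folklore] Fibres of `qqF n`. -/
theorem Kfib_qqF (κ l : Fin d) : Kfib (qqF (d := d) n) κ l = if κ = l then qqKer n κ else fun _ _ => 0 := by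
  funext x w
  by_cases h : κ = l <;> simp [Kfib, qqF, h]

/-- [folklore] **`Lap = n² · periodiseF lapF`** entrywise on `Site d (n·p) × Fin d` (Q4's matrix form). -/
theorem Lap_eq_periodiseF (x z : Fin d → ℤ) (κ l : Fin d) :
    Lap n (cubic d p) (castT (fine n (cubic d p)) x, κ) (castT (fine n (cubic d p)) z, l)
      = (((n : ℝ) ^ 2 * periodiseF (n * p) lapF (siteOf d (n * p) x, κ) (siteOf d (n * p) z, l) : ℝ) : ℂ) := by
  rw [Lap_entry, periodiseF_apply, Kfib_lapF]
  by_cases h : κ = l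
  · rw [if_pos h, if_pos h]
  · rw [if_neg h, if_neg h, periodise₂_zero]

/-- [folklore] **`QvAdj · QvOp = n^d·n^{−2(d+1)} · periodiseF (qqF n)`** entrywise on `Site d (n·p) × Fin d`. -/
theorem QvAdj_QvOp_eq_periodiseF (x z : Fin d → ℤ) (κ l : Fin d) :
    (QvAdj n (cubic d p) * QvOp n (cubic d p)) (castT (fine n (cubic d p)) x, κ) (castT (fine n (cubic d p)) z, l)
      = (((n : ℝ) ^ d * (1 / (n : ℝ) ^ (d + 1)) ^ 2 * periodiseF (n * p) (qqF n) (siteOf d (n * p) x, κ) (siteOf d (n * p) z, l)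
          : ℝ) : ℂ) := by
  rw [QvAdj_QvOp_entry, periodiseF_apply, Kfib_qqF]
  by_cases h : κ = l
  · rw [if_pos h, if_pos h]
  · rw [if_neg h, if_neg h, periodise₂_zero]

/-- [folklore] **MATRIX FORM on `Site d (n·p) × Fin d`** (Q4's per-volume shape for the vector Laplacian): every entry of an5's `Lap n (cubic d p)` is `n²` times the
entry of Q1's fibrewise periodisation of `lapF`. -/
theorem Lap_eq_periodiseF_site (i j : Site d (n * p) × Fin d) :
    Lap n (cubic d p) i j = (((n : ℝ) ^ 2 * periodiseF (n * p) lapF i j : ℝ) : ℂ) := by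
  obtain ⟨xb, κ⟩ := i
  obtain ⟨zb, l⟩ := j
  have h := Lap_entry_site n p xb zb κ l
  rw [periodiseF_apply, Kfib_lapF]
  by_cases hκ : κ = l
  · rw [if_pos hκ] at h; rw [if_pos hκ]; exact h
  · rw [if_neg hκ] at h; rw [if_neg hκ, periodise₂_zero]; exact h

/-- [folklore] **MATRIX FORM on `Site d (n·p) × Fin d`** for the averaging term: every entry of `QvAdj · QvOp` is `n^d·n^{−2(d+1)}` times the entry of
`periodiseF (n·p) (qqF n)`. -/
theorem QvAdj_QvOp_eq_periodiseF_site (i j : Site d (n * p) × Fin d) :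
    (QvAdj n (cubic d p) * QvOp n (cubic d p)) i j
      = (((n : ℝ) ^ d * (1 / (n : ℝ) ^ (d + 1)) ^ 2 * periodiseF (n * p) (qqF n) i j : ℝ) : ℂ) := by
  obtain ⟨xb, κ⟩ := i
  obtain ⟨zb, l⟩ := j
  have h := QvAdj_QvOp_entry_site n p xb zb κ l
  rw [periodiseF_apply, Kfib_qqF]
  by_cases hκ : κ = l
  · rw [if_pos hκ] at h; rw [if_pos hκ]; exact h
  · rw [if_neg hκ] at h; rw [if_neg hκ, periodise₂_zero]; exact h

end

end Summit.QuantumFields.BalabanUV.Beta.D1BFx.StencilDictionaryEntries
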